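import Mathlib
import HarnessLib.Audit
import Summits.PneNP.PneNP.Theorems.PstarCrossRowsAtCarrier
import Summits.PneNP.PneNP.Theorems.PstarCrossCaseTRows
import Summits.PneNP.PneNP.Theorems.PstarCrossCaseTEqPriv

/-!
# The blind free CROSS gate, regime T (node N3): the (EQ) chord ALONE leaves at most five core outputs (O2 / E1; prover-1 g23)

FRONTIER range-avoidance ladder, rung F-N3 (`stmt-PneNP-19007`), cell `pnp-ideate`; restricted-model proof complexity — nothing here bears on `P` versus `NP`.

Node N3 (`PstarCrossNodes.CrossCaseT`), the (EQ) sub-case `q_m = u_{e₀}` for a real chord `e₀` (`PstarCrossCaseTRows.caseT_row`'s second clean row) when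
`e₀` is the ONLY real chord.  Then both state-free parts vanish on the level set `{u_{e₀} = 1}`: `q_{(1,0)} + 1 + σ₂` by `PstarCrossCaseTRows.caseT_eq_q10`,
and `q_{(0,1)} + κ₁` because `q_m ∈ {q_{(0,1)}, q_{(0,1)} + q_{(1,0)}}` equals `u_{e₀}` (`PstarCrossCaseTEqPriv.qDir_one_one'`).  So the N4 endgame runs verbatim at LEVEL ONE
(`PstarCrossRowsAt*`): each row is clean or a non-degenerate product (`clean_or_nondeg_at`); both clean is `PstarCrossCaseU2Clean.false_of_clean`; every
private tree edge lies in `D e₀` (`untouched_of_row_at`, `cross_touch`); the budget gives `#J₀ ≤ 5` unless two private edges, which force `D e₀ = {π₁, π₂}`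
(`false_of_third_edge_at`) and then a carrier (`untouched_or_carrier_at`) that empties the carrier budget.

* **`crossCaseT_eq_single`** — regime T with `(N.erase e_q).erase e_p = {e₀}` and `q_m = u_{e₀}` has `#J₀ ≤ 5`.
What remains of N3 after this file and `PstarCrossCaseTRows`: the (EQ) chord with OTHER real chords (each `u_{e₂} = u_{e₀} +` non-degenerate product,
`caseT_eq_other`), the row `q_m ≡ 0`, and the non-degenerate product rows of `q_m`.
-/

set_option linter.dupNamespace false -- `Summit.PneNP.PneNP.…`: summit = sub-problem name (D-0017 single-conjunct layout)

open Finset Module Literature.Computability.Complexity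
open Summit.PneNP.PneNP.Theorems.PstarTyped (Typed)
open Summit.PneNP.PneNP.Theorems.PstarSALevel (varSet BoundaryExpanding SimpleOverlap)
open Summit.PneNP.PneNP.Theorems.PstarCentreFree (vars_mem_varSet)
open Summit.PneNP.PneNP.Theorems.PstarCubeIdeals (IsAffineFn IsQuadFn)
open Summit.PneNP.PneNP.Theorems.PstarProductRank (qform polar)
open Summit.PneNP.PneNP.Theorems.PstarReadSumset (V2)
open Summit.PneNP.PneNP.Theorems.PstarChordSystem (ChordSystem)
open Summit.PneNP.PneNP.Theorems.PstarChordBridgeTools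
open Summit.PneNP.PneNP.Theorems.PstarChordBridge
open Summit.PneNP.PneNP.Theorems.PstarChordBridgeForcing (freeMon gam sys_u_eq rank_four_of_wf)
open Summit.PneNP.PneNP.Theorems.PstarChordBridgeFundamental (two_le_card_of_even)
open Summit.PneNP.PneNP.Theorems.PstarChordBridgeBasis (qDir polarDir)
open Summit.PneNP.PneNP.Theorems.PstarGateCasePUnitsTouch (not_mem_C_of_qDir polarDir_single)
open Summit.PneNP.PneNP.Theorems.PstarCrossData (CrossData)
open Summit.PneNP.PneNP.Theorems.PstarCrossSystem
open Summit.PneNP.PneNP.Theorems.PstarCrossCorner (PrivEdge)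
open Summit.PneNP.PneNP.Theorems.PstarCrossBudget (cross_budget cross_touch)
open Summit.PneNP.PneNP.Theorems.PstarCrossBudgetCarriers (cross_budget_carriers)
open Summit.PneNP.PneNP.Theorems.PstarCrossCaseU2 (isQuadFn_qDir)
open Summit.PneNP.PneNP.Theorems.PstarCrossCaseU2Clean (false_of_clean)
open Summit.PneNP.PneNP.Theorems.PstarCrossCaseTRows (caseT_eq_q10)
open Summit.PneNP.PneNP.Theorems.PstarCrossRowsAt (clean_or_nondeg_at)
open Summit.PneNP.PneNP.Theorems.PstarCrossRowsAtCarrier (false_of_third_edge_at clean_cases untouched_of_row_at untouched_or_carrier_at)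
open Summit.PneNP.PneNP.Theorems.PstarCrossCaseTEqPriv (qDir_one_one')

namespace Summit.PneNP.PneNP.Theorems.PstarCrossCaseTEq

variable {n m : ℕ}

section

variable (I : LocalMap 4 n m) {r : ℕ} {B : BridgeData n m} {e_p e_q g₀ : Fin m}

/-- **Regime T, the (EQ) chord alone: `#J₀ ≤ 5`.**  See the module docstring. -/
theorem crossCaseT_eq_single (hI : I.IsPure xorAndPred) (hT : Typed I) (hS : SimpleOverlap I) (hB : BoundaryExpanding r I)
    (hD : CrossData I r B e_p e_q g₀) {mv : V2} (hmvT : mv = (0, 1) ∨ mv = (1, 1))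
    (hline : ∀ e ∈ (B.N.erase e_q).erase e_p,
      (((sys I B).vsys e_p e_q).ρ e 0 = 0 ∨ ((sys I B).vsys e_p e_q).ρ e 0 = mv) ∧
      (((sys I B).vsys e_p e_q).ρ' e 0 = 0 ∨ ((sys I B).vsys e_p e_q).ρ' e 0 = mv))
    (hread : ∀ e ∈ (B.N.erase e_q).erase e_p, ((sys I B).vsys e_p e_q).ρ e 0 ≠ 0 ∨ ((sys I B).vsys e_p e_q).ρ' e 0 ≠ 0)
    {e₀ : Fin m} (hE : (B.N.erase e_q).erase e_p = {e₀}) (hq : ∀ x, qDir I B mv x = (sys I B).u e₀ x) : B.J₀.card ≤ 5 := by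
  classical
  have hW := hD.wf
  have he₀' : e₀ ∈ (B.N.erase e_q).erase e_p := by rw [hE]; exact mem_singleton_self _
  have he₀ : e₀ ∈ B.N := mem_of_mem_erase (mem_of_mem_erase he₀')
  -- `#N = 3`, `#(J₀ ∖ N) ≥ #(D e₀) ≥ 2`
  have hN : B.N = insert e_q (insert e_p {e₀}) := by
    rw [← insert_erase hD.mem_q, ← insert_erase (mem_erase.2 ⟨hD.ne, hD.mem_p⟩ : e_p ∈ B.N.erase e_q), hE]
  have hN3 : B.N.card = 3 := by
    rw [hN, card_insert_of_notMem, card_insert_of_notMem, card_singleton]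
    · exact fun h => (ne_of_mem_erase he₀').symm (mem_singleton.1 h)
    · rw [mem_insert, mem_singleton]; push Not
      exact ⟨hD.ne.symm, fun h => (ne_of_mem_erase (mem_of_mem_erase he₀')).symm h⟩
  have hDe : 2 ≤ (B.D e₀).card :=
    two_le_card_of_even I hI hS (fun h => (mem_sdiff.1 (hW.hD e₀ he₀ h)).2 he₀) (hW.hDeven e₀ he₀)
  have hDT : (B.D e₀).card ≤ (B.J₀ \ B.N).card := card_le_card (hW.hD e₀ he₀)
  have hJcard : (B.J₀ \ B.N).card + B.N.card = B.J₀.card := card_sdiff_add_card_eq_card hW.hN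
  -- both state-free parts vanish on `{u₀ = 1}`
  set κ₂ : ZMod 2 := 1 + ∑ e ∈ (B.N.erase e_q).erase e_p, ((((sys I B).vsys e_p e_q).ρ e 0).2 + (((sys I B).vsys e_p e_q).ρ' e 0).2) with hκ₂
  have e10 : ∀ a : ZMod 2, a = 1 → a + 1 = 0 := by decide
  have hZ10 : ∀ x, (sys I B).u e₀ x = 1 → qDir I B (1, 0) x + κ₂ = 0 := fun x hx =>
    caseT_eq_q10 I hI hT hD hmvT hline hread hq (e10 _ hx)
  obtain ⟨κ₁, hZ01⟩ : ∃ κ₁ : ZMod 2, ∀ x, (sys I B).u e₀ x = 1 → qDir I B (0, 1) x + κ₁ = 0 := by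
    rcases hmvT with rfl | rfl
    · exact ⟨1, fun x hx => by rw [hq x]; exact e10 _ hx⟩
    · refine ⟨1 + κ₂, fun x hx => ?_⟩
      have h11 := hq x
      rw [qDir_one_one'] at h11
      have h2 := hZ10 x hx
      rw [hx] at h11
      revert h11 h2
      generalize qDir I B (0, 1) x = a; generalize qDir I B (1, 0) x = b; generalize κ₂ = k
      revert a b k; decide
  have hr10 := clean_or_nondeg_at I hI hS hB hD he₀ (isQuadFn_qDir I B (1, 0) κ₂) hZ10
  have hr01 := clean_or_nondeg_at I hI hS hB hD he₀ (isQuadFn_qDir I B (0, 1) κ₁) hZ01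
  -- both rows clean: done (`false_of_clean`)
  by_cases hboth : ((∀ x, qDir I B (1, 0) x + κ₂ = 0) ∨ (∀ x, qDir I B (1, 0) x + κ₂ = (sys I B).u e₀ x + 1)) ∧
      ((∀ x, qDir I B (0, 1) x + κ₁ = 0) ∨ (∀ x, qDir I B (0, 1) x + κ₁ = (sys I B).u e₀ x + 1))
  · obtain ⟨κ₂', h10⟩ := clean_cases I hboth.1
    obtain ⟨κ₁', h01⟩ := clean_cases I hboth.2
    exact (false_of_clean I hI hT hS hB hD hE h10 h01).elim
  -- otherwise some row is a non-degenerate product vanishing on `{u₀ = 1}`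
  obtain ⟨μ₁, μ₂, h₁, h₂, hn₁, hn₂, hn, hZ⟩ : ∃ μ₁ μ₂ : (Fin n → ZMod 2) → ZMod 2, IsAffineFn μ₁ ∧ IsAffineFn μ₂ ∧
      (∃ z, μ₁ z ≠ μ₁ 0) ∧ (∃ z, μ₂ z ≠ μ₂ 0) ∧ (∃ z, μ₁ z + μ₁ 0 ≠ μ₂ z + μ₂ 0) ∧ ∀ x, (sys I B).u e₀ x = 1 → μ₁ x * μ₂ x = 0 := by
    have e11 : ∀ k : ZMod 2, 1 + (0 + 1) = k → k = 0 := by decide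
    rcases hr10 with hc10 | ⟨μ₁, μ₂, h₁, h₂, hn₁, hn₂, hn, hrow⟩
    · rcases hr01 with hc01 | ⟨μ₁, μ₂, h₁, h₂, hn₁, hn₂, hn, hrow⟩
      · exact absurd ⟨hc10, hc01⟩ hboth
      · refine ⟨μ₁, μ₂, h₁, h₂, hn₁, hn₂, hn, fun x hx => ?_⟩
        rcases hrow with h | h
        · rw [← h x, hZ01 x hx]
        · exact e11 _ (by rw [← h x, hZ01 x hx, hx])
    · refine ⟨μ₁, μ₂, h₁, h₂, hn₁, hn₂, hn, fun x hx => ?_⟩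
      rcases hrow with h | h
      · rw [← h x, hZ10 x hx]
      · exact e11 _ (by rw [← h x, hZ10 x hx, hx])
  -- the constraint data
  have hGfree : ∀ G : Finset (Fin m), (∀ v ∈ privs I B.N, ∀ g ∈ G, I.vars g 2 ≠ v ∧ I.vars g 3 ≠ v) →
      ∀ g ∈ G, ¬ (I.vars g 2 ∈ privs I B.N ∨ I.vars g 3 ∈ privs I B.N) := by
    intro G h g hg hor
    rcases hor with h2 | h3
    · exact (h _ h2 g hg).1 rfl
    · exact (h _ h3 g hg).2 rfl
  have hd₁ : Disjoint B.G₁ B.J₀ := Finset.disjoint_of_subset_left (subset_insert g₀ B.G₁) hD.disj₁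
  have hGf₁ := hGfree B.G₁ fun v hv => (hD.hun v hv).1
  have hGf₂ := hGfree B.G₂ fun v hv => (hD.hun v hv).2
  have hlin₁ : ∀ (π : Fin m) (s : Fin 4), π ∈ B.J₀ \ B.N → 2 ≤ s.val →
      qDir I B (0, 1) (Pi.single (I.vars π s) 1) = qDir I B (0, 1) 0 → I.vars π s ∉ B.C₁ :=
    fun π s hπ hs h => (not_mem_C_of_qDir I hI hT hW hπ hs).1 h
  have hlin₂ : ∀ (π : Fin m) (s : Fin 4), π ∈ B.J₀ \ B.N → 2 ≤ s.val →
      qDir I B (1, 0) (Pi.single (I.vars π s) 1) = qDir I B (1, 0) 0 → I.vars π s ∉ B.C₂ :=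
    fun π s hπ hs h => (not_mem_C_of_qDir I hI hT hW hπ hs).2 h
  have hpol₁ : ∀ c d : Fin n, polarDir I B (0, 1) (Pi.single c 1) (Pi.single d 1) =
      ((polar B.T₁ (fun j => I.vars j 2) (fun j => I.vars j 3) + polar (freeMon I B.N B.G₁) (fun j => I.vars j 2) (fun j => I.vars j 3) :
        LinearMap.BilinForm (ZMod 2) (Fin n → ZMod 2)) (Pi.single c 1)) (Pi.single d 1) := fun c d => by
    rw [polarDir_single]; simp
  have hpol₂ : ∀ c d : Fin n, polarDir I B (1, 0) (Pi.single c 1) (Pi.single d 1) =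
      ((polar B.T₂ (fun j => I.vars j 2) (fun j => I.vars j 3) + polar (freeMon I B.N B.G₂) (fun j => I.vars j 2) (fun j => I.vars j 3) :
        LinearMap.BilinForm (ZMod 2) (Fin n → ZMod 2)) (Pi.single c 1)) (Pi.single d 1) := fun c d => by
    rw [polarDir_single]; simp
  -- every private tree edge lies in `D e₀`
  have hmemD : ∀ π, PrivEdge I B π → π ∈ B.D e₀ := fun π hπ => by
    by_contra hπD
    obtain ⟨hC₁, hG₁⟩ := untouched_of_row_at I hI hS hB hD he₀ (mv := (0, 1)) hW.hT₁ hd₁ hGf₁ hlin₁ hpol₁ hr01 hZ01 hπ hπD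
    obtain ⟨hC₂, hG₂⟩ := untouched_of_row_at I hI hS hB hD he₀ (mv := (1, 0)) hW.hT₂ hD.disj₂ hGf₂ hlin₂ hpol₂ hr10 hZ10 hπ hπD
    exact cross_touch I hI hD hπ.1 hπ.2 hC₁ hC₂ hG₁ hG₂
  -- the budget without carriers: done unless there are two private edges
  obtain ⟨Pv, hPvT, hpriv, hcount⟩ := cross_budget I hB hD
  have hPvE : ∀ π ∈ Pv, PrivEdge I B π := fun π hπ => ⟨hPvT hπ, fun j hj hne => hpriv π hπ j (mem_insert_of_mem hj) hne⟩
  by_cases hPv1 : Pv.card ≤ 1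
  · omega
  obtain ⟨π₁, hπ₁P, π₂, hπ₂P, h12⟩ := (one_lt_card (s := Pv)).1 (by omega)
  exfalso
  have hπ₁ := hPvE π₁ hπ₁P
  have hπ₂ := hPvE π₂ hπ₂P
  have hπ₁D := hmemD π₁ hπ₁
  have hπ₂D := hmemD π₂ hπ₂
  have hπ₁J : π₁ ∈ B.J₀ := (mem_sdiff.1 hπ₁.1).1
  have hπ₂J : π₂ ∈ B.J₀ := (mem_sdiff.1 hπ₂.1).1
  -- no third edge: `D e₀ = {π₁, π₂}`
  have hD2 : ∀ j ∈ B.D e₀, j = π₁ ∨ j = π₂ := fun j hj => by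
    by_contra hno
    push Not at hno
    exact false_of_third_edge_at I hI hS hB hD he₀ h₁ h₂ hn₁ hn₂ hn hZ hπ₁ hπ₂ h12 hπ₁D hπ₂D hj hno.1 hno.2
  -- a carrier
  obtain ⟨o, hoG, s, s₂, hs, hs₂, hoor⟩ : ∃ o ∈ B.G₁ ∪ B.G₂, ∃ s s₂ : Fin 4, (s = 2 ∨ s = 3) ∧ (s₂ = 2 ∨ s₂ = 3) ∧
      ((I.vars o 2 = I.vars π₂ s₂ ∧ I.vars o 3 = I.vars π₁ s) ∨ (I.vars o 2 = I.vars π₁ s ∧ I.vars o 3 = I.vars π₂ s₂)) := by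
    rcases untouched_or_carrier_at I hI hS hB hD he₀ (mv := (0, 1)) hW.hT₁ hd₁ hGf₁ hlin₁ hpol₁ hr01 hZ01 hπ₁ h12 hπ₂D hD2 with
      ⟨hC₁, hG₁⟩ | ⟨o, ho, s, s₂, hs, hs₂, hoor⟩
    · rcases untouched_or_carrier_at I hI hS hB hD he₀ (mv := (1, 0)) hW.hT₂ hD.disj₂ hGf₂ hlin₂ hpol₂ hr10 hZ10 hπ₁ h12 hπ₂D hD2 with
        ⟨hC₂, hG₂⟩ | ⟨o, ho, s, s₂, hs, hs₂, hoor⟩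
      · exact (cross_touch I hI hD hπ₁.1 hπ₁.2 hC₁ hC₂ hG₁ hG₂).elim
      · exact ⟨o, mem_union_right _ (mem_filter.1 ho).1, s, s₂, hs, hs₂, hoor⟩
    · exact ⟨o, mem_union_left _ (mem_filter.1 ho).1, s, s₂, hs, hs₂, hoor⟩
  have hoJ : o ∉ B.J₀ := by
    rcases mem_union.1 hoG with h | h
    · exact Finset.disjoint_left.1 hd₁ h
    · exact Finset.disjoint_left.1 hD.disj₂ h
  have hog₀ : g₀ ∉ ({o} : Finset (Fin m)) := by
    rw [mem_singleton]
    intro h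
    rw [← h] at hoG
    rcases mem_union.1 hoG with h' | h'
    · exact hD.gate_nmem h'
    · exact ((hD.hun _ (vars_mem_privs I hD.mem_p (s := 2) (by decide))).2 g₀ h').1 hD.gate_vars.1
  have hoO : ({o} : Finset (Fin m)) ⊆ B.G₁ ∪ B.G₂ := singleton_subset_iff.2 hoG
  have hold : ∀ o' ∈ ({o} : Finset (Fin m)), (∃ j ∈ B.J₀, I.vars o' 2 ∈ varSet I j) ∧ (∃ j ∈ B.J₀, I.vars o' 3 ∈ varSet I j) := by
    intro o' ho'
    rw [mem_singleton] at ho'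
    subst ho'
    rcases hoor with ⟨h2, h3⟩ | ⟨h2, h3⟩
    · exact ⟨⟨π₂, hπ₂J, h2 ▸ vars_mem_varSet I π₂ s₂⟩, ⟨π₁, hπ₁J, h3 ▸ vars_mem_varSet I π₁ s⟩⟩
    · exact ⟨⟨π₁, hπ₁J, h2 ▸ vars_mem_varSet I π₁ s⟩, ⟨π₂, hπ₂J, h3 ▸ vars_mem_varSet I π₂ s₂⟩⟩
  obtain ⟨Pv', hPv'T, hpriv', hcount'⟩ :=
    cross_budget_carriers I hB hD hoO (disjoint_singleton_left.2 hoJ) hog₀ hold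
  -- no private edge survives the carrier
  have hoX : o ∈ ({o} : Finset (Fin m)) ∪ insert g₀ B.J₀ := mem_union_left _ (mem_singleton_self o)
  have hread₁ : I.vars π₁ s ∈ varSet I o := by
    rcases hoor with ⟨-, h3⟩ | ⟨h2, -⟩
    · exact h3 ▸ vars_mem_varSet I o 3
    · exact h2 ▸ vars_mem_varSet I o 2
  have hread₂ : I.vars π₂ s₂ ∈ varSet I o := by
    rcases hoor with ⟨h2, -⟩ | ⟨-, h3⟩
    · exact h2 ▸ vars_mem_varSet I o 2
    · exact h3 ▸ vars_mem_varSet I o 3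
  have hPv'0 : Pv' = ∅ := by
    refine eq_empty_of_forall_notMem fun j hj => ?_
    have hjE : PrivEdge I B j := ⟨hPv'T hj, fun j' hj' hne => hpriv' j hj j' (mem_union_right _ (mem_insert_of_mem hj')) hne⟩
    have hjo : o ≠ j := fun h => hoJ (h ▸ (mem_sdiff.1 (hPv'T hj)).1)
    have hp := hpriv' j hj o hoX hjo
    rcases hD2 j (hmemD j hjE) with rfl | rfl
    · rcases hs with rfl | rfl
      · exact hp.1 hread₁
      · exact hp.2 hread₁
    · rcases hs₂ with rfl | rfl
      · exact hp.1 hread₂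
      · exact hp.2 hread₂
  rw [hPv'0, card_empty, card_singleton, hN3] at hcount'
  omega


end

end Summit.PneNP.PneNP.Theorems.PstarCrossCaseTEq
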